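import Summits.QuantumFields.YangMills.Theses.ParabolicTrajectory
import Summits.QuantumFields.YangMills.Theorems.LatticeGapOnTrajectory.Negative.ZeroCouplingGap
import Summits.QuantumFields.YangMills.Theorems.LatticeGapOnTrajectory.Negative.BlowUp
import Summits.QuantumFields.YangMills.Theorems.LatticeGapOnTrajectory.Negative.StubUVPassage
import Summits.QuantumFields.YangMills.Theorems.LatticeGapOnTrajectory.Negative.StubAnchoring

/-!
# Line `dissipative-bridge` — skeleton for the crux `ParabolicTrajectory.LatticeGapOnTrajectory`
(crux item stmt-QuantumFields-10523, conjunct (B) of route `route-QuantumFields-ParabolicTrajectory`, rev 4)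

Crux (FIXED, by name): for every compact simple `G`, lattice representation `r`, `M ≥ 2`, `θ > 0`
and every `M`-adic Wilson scheme `sch` (`a_k = M^{-n_k}`) with `β_k → ∞` whose dimensionless
curvature two-point function at physical separation `1` tends to `θ`, there is `Δ > 0` with
`HasLatticeMassGap r sch Δ` (lattice half) and `T.HasMassGap Δ` for every OS continuum limit `T`
along `sch` up to species renormalisations (transfer half).

## The line in one paragraph (card `Ideas/dissipative-bridge.md`, triage r1-1/2/3: pass)

Near the renormalised trajectory the exact block-spin map is DISSIPATIVE: one neutral (parabolic)
coupling direction, everything else contracting. That is exactly the "finitely many Galerkin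
modes + uniformly damped tail" structure under which Zgliczyński–Mischaikow self-consistent bounds
enclose orbits of an infinite-dimensional map by a FINITE certified computation. So: (1) every
Wilson orbit with `β → ∞` passes, inside Bałaban's chart, through a fixed fat TUBE
`{γ ≤ g ≤ γ⁺, ‖y‖ ≤ ρ}` around the trajectory (pure dynamics of the hypothesis structure
`BalabanBanachStep`: parabolic drift + fibre absorption — `UVPassage`, no λ-lemma needed because
the tube is fat); (2) in a GLOBAL extension of the chart (the posited object `BridgeChart`: a
Banach space `X` of effective unit-lattice gauge theories in holonomy/polymer coordinates, one
exact block-spin step `Fext` of ODD factor `M'`, the chart embedded equivariantly, an open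
"polymer ball" `H`) a tail-trapping CERTIFICATE (`TrappingData`: Galerkin projection `P`, boxes
`N 0 … N J`, tail radius/damping `ρt, θt, ηt`) encloses the forward orbit of the tube for `J`
steps and lands it in `H` — the computer-assisted heteroclinic connection "asymptotically free
point → high-temperature fixed point" (`BridgeChartExists`; its logical core `tailTrapping` is
PROVED below); (3) membership of a Wilson descendant in `H` is transported back to clustering of
the FINE Wilson theory at lattice rate `κ / M'^{j+J}` on all large tori (the `transport` pin of
the chart = polymer-ball clustering for quasi-local actions + un-blocking by reflection-positive
un-smearing + volume robustness); (4) the tuning datum `θ > 0` is used exactly once, to ANCHOR the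
landing step `j_k` to the physical scale: `M'^{j_k} ≤ M'^{w(θ)} M^{n_k}` (`ScaleAnchoring`, from
the chart's ultraviolet correlator bound `uv_bound` + the drift count), whence
`Δ = κ / M'^{w(θ)+J}`; (5) the transfer half follows from the lattice half by positivity of the
transfer matrix (`LatticeToTransfer`, Disproof PROVER NOTE).

## Skeleton (4 registered stubs + proved lemmas + kernel-checked composition)

* `stub_uvPassage : UVPassage` (M, provable now, shared with rt-arc-collapse / one-orbit-suffices)
* `stub_bridgeChart : BridgeChartExists` (XL — HARDEST: representation problem D1, polymer-ball
  clustering D2 + un-blocking + volume robustness C1 as the `transport` field, the UV correlator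
  bound, and the certified enclosure)
* `stub_anchoring : ScaleAnchoring` (M, provable from the fields `uv_bound` + drift dynamics)
* `stub_transfer : LatticeToTransfer` (M/L, shared by every line on this crux; its hypothesis is
  the `k`-UNIFORM lattice gap `UniformLatticeGap`, which the composition proves on the way)
* proved: `tailTrapping` (self-consistent bounds, map version), `exists_wilson_point`
  (`betaOf` is onto every large `β`), `exists_tubeAdmissible` (admissible tubes exist arbitrarily
  deep in every chart), `hasLatticeMassGap_of_uniformLatticeGap`, `le_tubeTop`;
* `LatticeGapOnTrajectory_of : UVPassage → ScaleAnchoring → LatticeToTransfer →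
  BridgeChartExists → LatticeGapOnTrajectory` (real proof) and
  `LatticeGapOnTrajectory_skeleton : LatticeGapOnTrajectory` from the four sorried stubs.

## Why the enclosure lives inside the existence stub (junk-robustness)

A certificate/enclosure statement quantified over ALL inhabitants of `BridgeChart S` is false for
junk inhabitants (`H = ∅` satisfies every field), and `BalabanBanachStep` itself does not pin the
running of its coupling coordinate to the physical one-loop rate (Disproof of stmt-9684, §D caveat
"b₀κ unpinned"), so the ultraviolet correlator bound is a FIELD (`uv_bound`) asserted for the
constructed chart, not a `∀ S` stub. Everything quantified `∀ S` / `∀ 𝔛` below (`UVPassage`,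
`ScaleAnchoring`) is derivable from the fields alone; everything that names the specific map sits
in ONE existential (`BridgeChartExists`) whose conjuncts are the named sub-obligations.

## Disproof.lean (v3.7, RESISTS) honoured

* §5 `WithoutBeta` (β_k → ∞ load-bearing): used — `exists_wilson_point` + `UVPassage` need Wilson
  points `g → 0⁺`, i.e. `Tendsto sch.β atTop atTop`; finite-β parasites never enter the chart.
* §5 `WithoutTuning` / `0 < θ`: used — exactly in `stub_anchoring` (without the tuning the landing
  scale `M'^{j_k}` is unrelated to `a_k⁻¹` and no `Δ` survives; §6(i): `Δ = κ/M'^{w(θ)+J} → 0` as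
  `θ → 0⁺`, no θ-uniform rate is claimed).
* §5 `WithoutSimple`: `BridgeChartExists` is stated under `IsCompactSimpleLieGroup G`; for `U(1)`
  (`b = 0`, no drift; Coulomb phase) no chart with an enclosure into a clustering `H` can exist —
  the certificate is `G`-specific (MK barrier evaded: exact map, rigorous tail).
* §1 `two_le_of_shape` / `crux_iff_withoutM`: `2 ≤ M` is unused; the chart's block factor `M'` is
  ODD (field `odd_M`, triage C2) and independent of the scheme's `M` (price: the factor `M'^{w+J}`).
* §2 `concl_iff_split`: the two halves are closed at the same rate, transfer from lattice.
* §4 `transferHalf_inhabited`, `exists_renorm_not_isYangMillsFor` (landed `Negative/BlowUp`),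
  `hasLatticeMassGap_of_zero_coupling` (landed `Negative/ZeroCouplingGap`): imported below; no
  stub is an instance they refute (`LatticeToTransfer` carries `β_k → ∞`; trivial/empty fibres
  are harmless to a positivity transfer; no stub asserts a gap at `β ≡ 0` or without tuning).
-/

open scoped SchwartzMap
open MeasureTheory Filter Topology
open Literature.MathematicalPhysics.AQFT Literature.MathematicalPhysics.QuantumLattice
open Literature.Probability.LatticeModels
open Literature.MathematicalPhysics.QuantumFieldTheory

noncomputable section

namespace Summit.QuantumFields.YangMills.Cruxes.LatticeGapOnTrajectory.DissipativeBridge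

set_option linter.unusedVariables false

/-! ### 1. Tail trapping (Zgliczyński–Mischaikow self-consistent bounds, map version) — PROVED -/

section Trapping

variable {X : Type} [NormedAddCommGroup X] [NormedSpace ℝ X]

/-- **Trapping data** for a map `F` on a normed space: an idempotent continuous linear `P`
(Galerkin projection onto finitely many relevant + slow couplings), a chain of boxes
`N 0, …, N J ⊆ range P`, a tail radius `ρ`, a tail contraction rate `θ < 1` with defect
`η ≤ (1 − θ) ρ`; on every box the image tail is damped for every admissible tail, and the
projected image of box `i` with ANY admissible tail lies in box `i + 1` (the finite certified
covering computation). [folklore] -/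
def TrappingData (F : X → X) (P : X →L[ℝ] X) (N : ℕ → Set X) (ρ θ η : ℝ) (J : ℕ) : Prop :=
  (∀ x, P (P x) = P x) ∧ 0 ≤ ρ ∧ 0 ≤ θ ∧ θ < 1 ∧ 0 ≤ η ∧ η ≤ (1 - θ) * ρ ∧
  (∀ i, ∀ x ∈ N i, P x = x) ∧
  (∀ i < J, ∀ x ∈ N i, ∀ w : X, P w = 0 → ‖w‖ ≤ ρ →
      ‖F (x + w) - P (F (x + w))‖ ≤ θ * ‖w‖ + η) ∧
  (∀ i < J, ∀ x ∈ N i, ∀ w : X, P w = 0 → ‖w‖ ≤ ρ → P (F (x + w)) ∈ N (i + 1))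

/-- **Tail trapping** (the card's first lemma, proved): under `TrappingData`, every orbit
started in `N 0 ⊕ {‖tail‖ ≤ ρ}` satisfies `P (F^[i] z) ∈ N i` and `‖tail (F^[i] z)‖ ≤ ρ` for
all `i ≤ J`. Pure forward trapping: no expanding direction, no degree argument. [folklore] -/
theorem tailTrapping {F : X → X} {P : X →L[ℝ] X} {N : ℕ → Set X} {ρ θ η : ℝ} {J : ℕ}
    (h : TrappingData F P N ρ θ η J) (z : X) (h0 : P z ∈ N 0) (hz : ‖z - P z‖ ≤ ρ) :
    ∀ i ≤ J, P (F^[i] z) ∈ N i ∧ ‖F^[i] z - P (F^[i] z)‖ ≤ ρ := by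
  obtain ⟨hPP, hρ, hθ, hθ1, hη, hηρ, hN, hdamp, hcover⟩ := h
  intro i
  induction i with
  | zero => intro _; exact ⟨by simpa using h0, by simpa using hz⟩
  | succ i ih =>
    intro hi
    have hiJ : i < J := Nat.lt_of_succ_le hi
    obtain ⟨hx, hw⟩ := ih hiJ.le
    set u : X := F^[i] z with hu
    have hPw : P (u - P u) = 0 := by rw [map_sub, hPP, sub_self]
    have hsplit : F^[i + 1] z = F (P u + (u - P u)) := by
      rw [Function.iterate_succ_apply', add_sub_cancel]
    refine ⟨?_, ?_⟩
    · rw [hsplit]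
      exact hcover i hiJ (P u) hx (u - P u) hPw hw
    · rw [hsplit]
      calc ‖F (P u + (u - P u)) - P (F (P u + (u - P u)))‖
          ≤ θ * ‖u - P u‖ + η := hdamp i hiJ (P u) hx (u - P u) hPw hw
        _ ≤ θ * ρ + (1 - θ) * ρ := add_le_add (mul_le_mul_of_nonneg_left hw hθ) hηρ
        _ = ρ := by ring

end Trapping

/-! ### 2. Tube geometry in Bałaban's chart (over the hypothesis structure `BalabanBanachStep`) -/

section Chart

variable {G : Type} [Group G] [TopologicalSpace G] [IsTopologicalGroup G] [CompactSpace G]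
  [MeasurableSpace G] [BorelSpace G] {r : LatticeRep G} {M : ℕ} (S : BalabanBanachStep G r M)

/-- Orbit history: the first `j` iterates of `p` under the step stay in the chart-basin region
`[0, δ] × B̄_R` on which the structure's covariance (4a), contraction and parabolic bounds hold.
[folklore] -/
def InChart (p : ℝ × S.E) (j : ℕ) : Prop :=
  ∀ l ≤ j, (S.F^[l] p).1 ∈ Set.Icc 0 S.δ ∧ ‖(S.F^[l] p).2‖ ≤ S.R

/-- Top of the tube started at coupling `γ`: one full step's overshoot allowance,
`γ⁺ = γ + (b + C (δ + R)) γ³` (from `remainder_basin`). [folklore] -/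
def tubeTop (γ : ℝ) : ℝ := γ + (S.b + S.C * (S.δ + S.R)) * γ ^ 3

/-- The fat tube `{(g, y) : γ ≤ g ≤ γ⁺, ‖y‖ ≤ ρ}` around the trajectory — the initial set of the
certified enclosure and the landing set of `UVPassage`. [folklore] -/
def Tube (γ ρ : ℝ) : Set (ℝ × S.E) :=
  {p | γ ≤ p.1 ∧ p.1 ≤ tubeTop S γ ∧ ‖p.2‖ ≤ ρ}

/-- **Admissible tubes**: the smallness conditions (in terms of the structure's constants only)
under which the parabolic drift provably carries every small-coupling Wilson orbit into the tube
with an absorbed fibre coordinate: `γ⁺ ≤ δ`, `ρ ≤ R`, absorption radius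
`2 C γ⁺² ≤ (1 − θ') ρ`, positive drift `C (γ⁺ + ρ) ≤ b / 2`, and one crude smallness bound
(the coupling never halves in one step). Satisfiable for every small `γ` with `ρ ≍ γ⁺²`
(`exists_tubeAdmissible`, proved). [folklore] -/
def TubeAdmissible (γ ρ : ℝ) : Prop :=
  0 < γ ∧ 0 < ρ ∧ ρ ≤ S.R ∧ tubeTop S γ ≤ S.δ ∧
  2 * S.C * (tubeTop S γ) ^ 2 ≤ (1 - S.θ') * ρ ∧
  S.C * (tubeTop S γ + ρ) ≤ S.b / 2 ∧
  S.C * (tubeTop S γ + S.R) * (tubeTop S γ) ^ 2 ≤ 1 / 2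

/-- `γ ≤ γ⁺` for `γ ≥ 0`. [folklore] -/
theorem le_tubeTop {γ : ℝ} (hγ : 0 ≤ γ) : γ ≤ tubeTop S γ := by
  unfold tubeTop
  have h1 : 0 ≤ S.b + S.C * (S.δ + S.R) := by
    have := S.b_pos; have := S.C_pos; have := S.δ_pos; have := S.R_pos
    positivity
  nlinarith [pow_nonneg hγ 3]

/-- **Wilson points exist at every large `β`**: `betaOf` is continuous and strictly decreasing on
`(0, g₀]` with `betaOf g → ∞` as `g → 0⁺`, so every `β ≥ betaOf g₁` is `betaOf g` for some
`g ∈ (0, g₁]` (intermediate value theorem). This is where `Tendsto sch.β atTop atTop` enters the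
line: a Wilson sequence `β_k → ∞` is a sequence of Wilson points `g_k → 0⁺`. [folklore] -/
theorem exists_wilson_point {g₁ : ℝ} (h0 : 0 < g₁) (h1 : g₁ ≤ S.g₀) :
    ∃ β₁ : ℝ, ∀ β : ℝ, β₁ ≤ β → ∃ g ∈ Set.Ioc 0 g₁, S.betaOf g = β := by
  refine ⟨S.betaOf g₁, fun β hβ => ?_⟩
  have hev : ∀ᶠ g in 𝓝[>] (0 : ℝ), β ≤ S.betaOf g := S.tendsto_betaOf.eventually_ge_atTop β
  have hev' : ∀ᶠ g in 𝓝[>] (0 : ℝ), g ∈ Set.Ioo 0 g₁ := Ioo_mem_nhdsGT h0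
  obtain ⟨ε, hε, hεI⟩ := (hev.and hev').exists
  have hcont : ContinuousOn S.betaOf (Set.Icc ε g₁) :=
    S.continuousOn_betaOf.mono fun x hx => ⟨hεI.1.trans_le hx.1, hx.2.trans h1⟩
  obtain ⟨g, hg, hgβ⟩ := intermediate_value_Icc' hεI.2.le hcont ⟨hβ, hε⟩
  exact ⟨g, ⟨hεI.1.trans_le hg.1, hg.2⟩, hgβ⟩

/-- **Admissible tubes exist arbitrarily deep in every chart** (tightness of `TubeAdmissible`:
the enclosure of `BridgeChartExists` may start at any small coupling; its tube constraint is
never the obstruction). Take `ρ = (2C/(1−θ') + 1) γ⁺²` and `γ → 0⁺`. [folklore] -/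
theorem exists_tubeAdmissible {ε : ℝ} (hε : 0 < ε) :
    ∃ γ ρ : ℝ, γ ≤ ε ∧ TubeAdmissible S γ ρ := by
  have hθ' := S.θ'_lt_one
  have hC := S.C_pos
  have h1θ : 0 < 1 - S.θ' := by linarith
  set K : ℝ := 2 * S.C / (1 - S.θ') + 1 with hK
  have hKpos : 0 < K := by positivity
  have ht0 : Tendsto (fun γ : ℝ => tubeTop S γ) (𝓝 0) (𝓝 0) := by
    have hc : Continuous fun γ : ℝ => tubeTop S γ := by unfold tubeTop; fun_prop
    simpa [tubeTop] using hc.tendsto 0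
  have ht : Tendsto (fun γ : ℝ => tubeTop S γ) (𝓝[>] 0) (𝓝 0) :=
    tendsto_nhdsWithin_of_tendsto_nhds ht0
  have hρ : Tendsto (fun γ : ℝ => K * tubeTop S γ ^ 2) (𝓝[>] 0) (𝓝 0) := by
    simpa using (ht.pow 2).const_mul K
  have h3 : Tendsto (fun γ : ℝ => S.C * (tubeTop S γ + K * tubeTop S γ ^ 2)) (𝓝[>] 0) (𝓝 0) := by
    simpa using (ht.add hρ).const_mul S.C
  have h4 : Tendsto (fun γ : ℝ => S.C * (tubeTop S γ + S.R) * tubeTop S γ ^ 2) (𝓝[>] 0) (𝓝 0) := by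
    simpa using ((ht.add_const S.R).const_mul S.C).mul (ht.pow 2)
  have e0 : ∀ᶠ γ in 𝓝[>] (0 : ℝ), γ ∈ Set.Ioo 0 ε := Ioo_mem_nhdsGT hε
  have e1 : ∀ᶠ γ in 𝓝[>] (0 : ℝ), K * tubeTop S γ ^ 2 ≤ S.R :=
    hρ.eventually (eventually_le_nhds S.R_pos)
  have e2 : ∀ᶠ γ in 𝓝[>] (0 : ℝ), tubeTop S γ ≤ S.δ := ht.eventually (eventually_le_nhds S.δ_pos)
  have e3 : ∀ᶠ γ in 𝓝[>] (0 : ℝ), S.C * (tubeTop S γ + K * tubeTop S γ ^ 2) ≤ S.b / 2 :=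
    h3.eventually (eventually_le_nhds (by linarith [S.b_pos]))
  have e4 : ∀ᶠ γ in 𝓝[>] (0 : ℝ), S.C * (tubeTop S γ + S.R) * tubeTop S γ ^ 2 ≤ 1 / 2 :=
    h4.eventually (eventually_le_nhds (by norm_num))
  obtain ⟨γ, hγ0, hγ1, hγ2, hγ3, hγ4⟩ := (e0.and (e1.and (e2.and (e3.and e4)))).exists
  have hγpos : 0 < γ := hγ0.1
  have htop : 0 < tubeTop S γ := hγpos.trans_le (le_tubeTop S hγpos.le)
  refine ⟨γ, K * tubeTop S γ ^ 2, hγ0.2.le, hγpos, by positivity, hγ1, hγ2, ?_, hγ3, hγ4⟩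
  have hKid : (1 - S.θ') * K = 2 * S.C + (1 - S.θ') := by
    rw [hK]; field_simp
  have hsq : 0 ≤ tubeTop S γ ^ 2 := sq_nonneg _
  calc 2 * S.C * tubeTop S γ ^ 2 ≤ (2 * S.C + (1 - S.θ')) * tubeTop S γ ^ 2 := by nlinarith
    _ = (1 - S.θ') * (K * tubeTop S γ ^ 2) := by rw [← hKid]; ring

end Chart

/-! ### 3. The line's object: the dissipative bridge chart (HYPOTHESIS STRUCTURE, no existence) -/

section Structures

variable {G : Type} [Group G] [TopologicalSpace G] [IsTopologicalGroup G] [CompactSpace G]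
  [MeasurableSpace G] [BorelSpace G] {r : LatticeRep G} {M' : ℕ}

/-- **The dissipative bridge chart over a Bałaban chart `S`** (definition request D1 of the
card made into a hypothesis structure; inhabiting it — with a certificate — is the stub
`BridgeChartExists`). Intended instance: `X` = a Banach space of effective unit-lattice gauge
theories in HOLONOMY/POLYMER coordinates (quasi-local gauge-invariant actions given the block
field, weighted norms with summable tails), `F` = ONE exact block-spin step of odd factor `M'`
(Bałaban's covariant averaging + fluctuation integral + rescaling, defined at every coupling
along the crossover tube as a convergent "high-temperature" integral GIVEN the block field — the
card's bet (1)), `ι` = the isometric copy of Bałaban's small-field chart on which `F = S.F`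
(`ι_step`), `H` = an OPEN polymer ball around the Haar (β = 0) fixed point (Kotecký–Preiss /
Osterwalder–Seiler smallness of the activities, with margin). Two OUTPUT PINS tie the chart to
Wilson's lattice theory (both are statements about `latticeConnectedCorr` at the Wilson points
`betaOf g`, so no junk inhabitant profits from them):
* `transport` — a Wilson descendant in `H` at block scale `M'^{j+m}` forces exponential
  clustering of ALL pairs of fine gauge-invariant local observables at lattice rate
  `κ / M'^{j+m}`, on EVERY torus of side `2T+1 ≥ c₁ M'^{j+m}` (internally: D2 polymer-ball
  clustering of the effective theory, volume by volume on the `M'`-adic tori reached by exact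
  covariance; un-blocking to POINT observables by reflection-positive un-smearing of block-scale
  smeared fields — Lüscher positivity of Wilson's transfer matrix on tori of any period; and
  volume robustness from `M'`-adic tori to all tori — triage C1 — by strong mixing at the far end);
* `uv_bound` — while the orbit is in the chart, the dimensionless plaquette two-point function
  at separations `D ∈ [M'^i, M'^{i+1})` is `≤ Cuv · g_i⁴` (`g_i` = running coupling after `i`
  steps; tree level two-gluon exchange with a Bałaban-regime remainder): this pins the chart's
  coupling coordinate to the physical running (Disproof-9684 §D caveat) and is where `θ > 0`
  will bite (`ScaleAnchoring`).
`odd_M`: blocks centred at sites (Bałaban/Dimock), so that `expect_wilson`'s odd tori propagate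
along orbits (triage C2); the scheme's `M` in (B) is unrelated to `M'`. [folklore] -/
structure BridgeChart (S : BalabanBanachStep G r M') where
  odd_M : Odd M'
  /-- The global chart: a real Banach space containing the tube region and the polymer ball. -/
  X : Type
  [instNormedAddCommGroup : NormedAddCommGroup X]
  [instNormedSpace : NormedSpace ℝ X]
  [instCompleteSpace : CompleteSpace X]
  /-- One exact block-spin step of factor `M'`, extended beyond Bałaban's chart. -/
  F : X → X
  /-- Bałaban's chart inside `X`. -/
  ι : ℝ × S.E → X
  /-- Equivariance on the chart-basin region: `F ∘ ι = ι ∘ S.F`. -/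
  ι_step : ∀ p : ℝ × S.E, p.1 ∈ Set.Icc 0 S.δ → ‖p.2‖ ≤ S.R → F (ι p) = ι (S.F p)
  /-- The polymer ball (target of the enclosure). -/
  H : Set X
  isOpen_H : IsOpen H
  /-- Clustering rate (per block) delivered inside the polymer ball. -/
  κ : ℝ
  κ_pos : 0 < κ
  /-- Volume threshold in blocks. -/
  c₁ : ℕ
  /-- OUTPUT PIN 1 (D2 + un-blocking + C1): a Wilson descendant in `H` at scale `M'^{j+m}`
  clusters on the fine lattice at rate `κ / M'^{j+m}`, all pairs of local observables, all tori
  of side `≥ c₁ M'^{j+m}`, constants depending on the pair only. -/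
  transport : ∀ A B : YMSpecies G, ∃ C : ℝ, ∀ g ∈ Set.Ioc 0 S.g₀, ∀ j : ℕ,
    InChart S (g, S.yW g) j →
    ∀ m : ℕ, F^[m] (ι (S.F^[j] (g, S.yW g))) ∈ H →
    ∀ T n : ℕ, c₁ * M' ^ (j + m) ≤ 2 * T + 1 → n ≤ T →
      |latticeConnectedCorr r.ρ (S.betaOf g) (2 * T + 1) A.F B.F n| ≤
        C * Real.exp (-(κ * n / (M' : ℝ) ^ (j + m)))
  /-- Constant of the ultraviolet correlator bound. -/
  Cuv : ℝ
  /-- OUTPUT PIN 2 (UV): dimensionless plaquette two-point function at scale `M'^i` is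
  `O(g_i⁴)` while the orbit is in the chart (volume at least `M'` times the separation). -/
  uv_bound : ∀ g ∈ Set.Ioc 0 S.g₀, ∀ i : ℕ, InChart S (g, S.yW g) i →
    ∀ L D : ℕ, M' ^ i ≤ D → D < M' ^ (i + 1) → M' * D ≤ L →
      (D : ℝ) ^ 8 *
          |latticeConnectedCorr r.ρ (S.betaOf g) (2 * L + 1) r.curvature.F r.curvature.F D| ≤
        Cuv * ((S.F^[i] (g, S.yW g)).1) ^ 4

attribute [instance] BridgeChart.instNormedAddCommGroup BridgeChart.instNormedSpace
  BridgeChart.instCompleteSpace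

end Structures

/-! ### 4. The line's lattice output: a `k`-uniform lattice gap -/

section Uniform

variable {G : Type} [Group G] [TopologicalSpace G] [IsTopologicalGroup G] [CompactSpace G]
  [MeasurableSpace G] [BorelSpace G] {ι : Type}

/-- **Uniform lattice mass gap**: `HasLatticeMassGap` with ONE threshold `k₀` for all pairs of
observables (the constant still depends on the pair — Disproof §6(ii) — only the eventuality is
uniform). This is what the line actually proves, and what the positivity transfer needs: at each
`k ≥ k₀` the transfer matrix of Wilson's theory at `β_k` then has spectral gap `≥ Δ a_k` on the
FULL physical Hilbert space (all local vectors at once), so products and smeared renormalised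
fields are controlled uniformly. The per-pair `∀ᶠ k` of `HasLatticeMassGap` alone would not place
`k`-dependent linear combinations of translates in the gapped spectral subspace. [folklore] -/
def UniformLatticeGap (r : LatticeRep G) (sch : SpeciesScheme ι) (Δ : ℝ) : Prop :=
  ∃ k₀ : ℕ, ∀ A B : YMSpecies G, ∃ C : ℝ, ∀ k : ℕ, k₀ ≤ k → ∀ S : ℕ, sch.L k ≤ S →
    ∀ n : ℕ, n ≤ S →
      |latticeConnectedCorr r.ρ (sch.β k) (2 * S + 1) A.F B.F n| ≤
        C * Real.exp (-(Δ * (sch.a k * n)))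

/-- The uniform lattice gap implies the crux's lattice half. [folklore] -/
theorem hasLatticeMassGap_of_uniformLatticeGap (r : LatticeRep G) (sch : SpeciesScheme ι) {Δ : ℝ}
    (h : UniformLatticeGap r sch Δ) : HasLatticeMassGap r sch Δ := by
  obtain ⟨k₀, hk₀⟩ := h
  intro A B
  obtain ⟨C, hC⟩ := hk₀ A B
  exact ⟨C, Filter.eventually_atTop.2 ⟨k₀, fun k hk => hC k hk⟩⟩

end Uniform

/-! ### 5. The four stub statements (plain `Prop`s; the registered obligations are `stub_*` in §6) -/

/-- **Stub statement 1 — `UVPassage` (M; pure dynamics over `BalabanBanachStep`; provable now).**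
For every admissible tube there is `g₁ ∈ (0, g₀]` such that the orbit of every Wilson point
`(g, yW g)`, `0 < g ≤ g₁`, ENTERS the tube at some step `j`, having stayed in the chart-basin
region up to `j`, with `j` the FIRST passage of the coupling above `γ`. Why true: basin
invariance `‖Ψ g y‖ ≤ θ'‖y‖ + C g²` keeps `‖y‖ ≤ R` and absorbs it into `‖y‖ ≤ ρ` after
`j₀(θ', R, ρ)` steps (`2Cγ⁺² ≤ (1−θ')ρ`); before absorption the coupling cannot halve
(`C(γ⁺+R)γ⁺² ≤ 1/2`), after it the drift is `≥ (b/2) g³` (`C(γ⁺+ρ) ≤ b/2`), so `g⁻²` drops by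
`≥ b/2` per step and `γ` is passed in finitely many steps, overshooting by at most
`(b + C(δ+R))γ³` (`remainder_basin`); `g₁` small makes the passage happen after `j₀`. No
attraction to the centre-unstable curve is needed (the tube is fat): this line does NOT lean on
`ParabolicCentreCurve`. [folklore] -/
def UVPassage : Prop :=
  ∀ (G : Type) [Group G] [TopologicalSpace G] [IsTopologicalGroup G] [CompactSpace G]
    [MeasurableSpace G] [BorelSpace G] (r : LatticeRep G) (M : ℕ) (S : BalabanBanachStep G r M)
    (γ ρ : ℝ), TubeAdmissible S γ ρ →
    ∃ g₁ : ℝ, 0 < g₁ ∧ g₁ ≤ S.g₀ ∧ ∀ g ∈ Set.Ioc 0 g₁, ∃ j : ℕ,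
      S.F^[j] (g, S.yW g) ∈ Tube S γ ρ ∧ InChart S (g, S.yW g) j ∧
      ∀ l < j, (S.F^[l] (g, S.yW g)).1 < γ

/-- **Stub statement 2 — `BridgeChartExists` (XL; HARDEST; the representation problem + the
computer-assisted enclosure).** For every compact simple Lie `G` and lattice representation `r`
there are an (odd) block factor `M'`, a Bałaban chart `S : BalabanBanachStep G r M'` (supplied
by the route's crux `BalabanStepParabolic`, stmt-9684, for `M' ≥ M₀` odd), a bridge chart `𝔛`
over it, an admissible tube `(γ, ρ)`, and a TAIL-TRAPPING CERTIFICATE `(P, N, ρt, θt, ηt, J)` for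
`𝔛.F` whose initial box-plus-tail contains `ι(Tube γ ρ)` and whose final box-plus-tail lies in the
polymer ball `𝔛.H`. Internal plan (sub-obligations, see the line card): L1 the global chart in
holonomy/polymer coordinates with exact covariance given the block field (Gibbsianness of the
blocked measures along the SU(N) Wilson tube — card bet (1)); L2 tail damping `θt < 1, ηt` on the
tube region (the crossover's one slow direction goes INTO `range P`, card bet (2)); L3 the finite
covering computation `P (F (x + w)) ∈ N (i+1)` by interval arithmetic with rigorous Haar/character
remainders over the continuous group; L4 `H` = KP/OS polymer ball, open; L5 `transport`
(D2 clustering for quasi-local actions + RP un-smearing + C1 volume robustness); L6 `uv_bound`.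
For `U(1)` no such data exist (no drift, Coulomb phase): the statement is `G`-specific, as the
barriers `MigdalKadanoffGroupBlindness` / `AbelianDeconfinementD4` demand. [folklore] -/
def BridgeChartExists : Prop :=
  ∀ (G : Type) [Group G] [TopologicalSpace G] [IsTopologicalGroup G] [CompactSpace G],
    IsCompactSimpleLieGroup G →
    letI : MeasurableSpace G := borel G
    haveI : BorelSpace G := ⟨rfl⟩
    ∀ (r : LatticeRep G), ∃ (M' : ℕ) (S : BalabanBanachStep G r M') (𝔛 : BridgeChart S)
      (γ ρ : ℝ), TubeAdmissible S γ ρ ∧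
      ∃ (P : 𝔛.X →L[ℝ] 𝔛.X) (N : ℕ → Set 𝔛.X) (ρt θt ηt : ℝ) (J : ℕ),
        TrappingData 𝔛.F P N ρt θt ηt J ∧
        (∀ p ∈ Tube S γ ρ, P (𝔛.ι p) ∈ N 0 ∧ ‖𝔛.ι p - P (𝔛.ι p)‖ ≤ ρt) ∧
        (∀ z : 𝔛.X, P z ∈ N J → ‖z - P z‖ ≤ ρt → z ∈ 𝔛.H)

/-- **Stub statement 3 — `ScaleAnchoring` (M; where the tuning and `θ > 0` enter; provable from
the chart's fields).** Over any Bałaban chart with a bridge chart and an admissible tube: for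
every `θ > 0` there are a lag `w` and `g₁ ∈ (0, g₀]` such that along the orbit of any Wilson point
`g ≤ g₁` which is in the chart up to step `j` with couplings `≤ γ⁺` throughout, at every EARLIER
scale `i ≤ j − w` the dimensionless plaquette two-point function at separations
`D ∈ [M'^i, M'^{i+1})` (volume `≥ M' D`) is at most `θ / 2`. Why true: if `g_i⁴ > θ/(2 Cuv)` the
drift count (absorption in `≤ j₀` steps during which the coupling at most halves per step, then
`g⁻²` drops by `≥ b/2` per step) pushes the coupling above `γ⁺` within
`w := j₀ + ⌈2·4^{j₀}/(b g_*²)⌉ + 1` steps, contradicting `g_l ≤ γ⁺` for `l ≤ j`; otherwise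
`uv_bound` gives `D⁸|⟨P;τ_D P⟩| ≤ Cuv g_i⁴ ≤ θ/2`. Contrapositive used by the composition: the
tuned scale `M^{n_k}` (value `→ θ`) cannot lie `w` or more steps below the landing step, so
`M'^{j_k} ≤ M'^{w} M^{n_k}` — Δ depends on θ through `w(θ)` (Disproof §6(i)). [folklore] -/
def ScaleAnchoring : Prop :=
  ∀ (G : Type) [Group G] [TopologicalSpace G] [IsTopologicalGroup G] [CompactSpace G]
    [MeasurableSpace G] [BorelSpace G] (r : LatticeRep G) (M' : ℕ) (S : BalabanBanachStep G r M')
    (𝔛 : BridgeChart S) (γ ρ : ℝ), TubeAdmissible S γ ρ → ∀ θ : ℝ, 0 < θ →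
    ∃ (w : ℕ) (g₁ : ℝ), 0 < g₁ ∧ g₁ ≤ S.g₀ ∧ ∀ g ∈ Set.Ioc 0 g₁, ∀ j : ℕ,
      InChart S (g, S.yW g) j → (∀ l ≤ j, (S.F^[l] (g, S.yW g)).1 ≤ tubeTop S γ) →
      ∀ i L D : ℕ, i + w ≤ j → M' ^ i ≤ D → D < M' ^ (i + 1) → M' * D ≤ L →
        (D : ℝ) ^ 8 *
            |latticeConnectedCorr r.ρ (S.betaOf g) (2 * L + 1) r.curvature.F r.curvature.F D| ≤
          θ / 2

/-- **Stub statement 4 — `LatticeToTransfer` (M/L; shared by every line on this crux).** Along a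
scheme with `β_k → ∞` (so `β_k ≥ 0` eventually: reflection positivity of Wilson's action), the
UNIFORM lattice gap at rate `Δ > 0` implies the transfer half at the same rate: every OS
continuum limit `T` along `sch` up to species renormalisations has `T.HasMassGap Δ`. Why true
(Disproof PROVER NOTE, sharpened): what transfers is POSITIVITY, not constants — at each `k ≥ k₀`,
letting `S → ∞` in the uniform bound for the diagonal pairs `(A, A)` shows that EVERY local vector
`ÂΩ` has spectral measure (Lüscher's positive transfer matrix) supported in `{1} ∪ [0, e^{−Δ a_k}]`,
hence — local vectors being total — the lattice Hamiltonian has NO spectrum in `(0, Δ)` in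
physical units on the full space, uniformly in `k ≥ k₀`; so for the OS vectors `Ψ_{F,k}` of any
species string, `|⟨Ψ_{F,k}, (e^{−tH_k} − P_Ω) Ψ_{G,k}⟩| ≤ e^{−Δt} ‖Ψ_{F,k}‖ ‖Ψ_{G,k}‖` up to
thermal corrections `O(e^{−Δ a_k L_k}) → 0` on the scheme's torus, with `‖Ψ_{F,k}‖²` the `t = 0`
truncated function, which CONVERGES by `IsYangMillsFor` (`ΘF̄ ⊗ F` is off-diagonal); limits give
`T.HasMassGap Δ` on product tensors, and density of product tensors among time-ordered append
tensors (Schwartz kernel theorem + E0) gives all `H`. Junk fibres (`transferHalf_inhabited`,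
`exists_renorm_not_isYangMillsFor`) are harmless: empty fibres are vacuous, the vacuum has every
gap. Why it might fail: the density step, and the finite-torus (thermal trace) → Laplace control
at fixed `k`. [folklore] -/
def LatticeToTransfer : Prop :=
  ∀ (G : Type) [Group G] [TopologicalSpace G] [IsTopologicalGroup G] [CompactSpace G]
    [MeasurableSpace G] [BorelSpace G] (r : LatticeRep G) (sch : SpeciesScheme (YMSpecies G))
    (Δ : ℝ), 0 < Δ → Tendsto sch.β atTop atTop → UniformLatticeGap r sch Δ →
    ∀ sch' : SpeciesScheme (YMSpecies G), sch'.a = sch.a → sch'.β = sch.β → sch'.L = sch.L →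
      ∀ T : OSData (YMSpecies G) 4, IsYangMillsFor r sch' T → T.HasMassGap Δ

/-! ### 6. The registered stubs -/

/-- Stub 1 — Wilson orbits enter the admissible tube (pure dynamics). LANDED: proved by the crux disprover
(cdisprove gen 3) for verbatim copies of this file's `InChart/tubeTop/Tube/TubeAdmissible/UVPassage`
(`Theorems/LatticeGapOnTrajectory/Negative/StubUVPassage.lean`, p74478, `Stubs.uvPassage_holds`); the two
statements agree definitionally, so the landed theorem closes this stub by `exact`. -/
theorem stub_uvPassage : UVPassage := by
  exact Summit.QuantumFields.YangMills.Theorems.LatticeGapOnTrajectory.Negative.Stubs.uvPassage_holds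

/-- Stub 2 — the bridge chart with a certified enclosure exists (HARDEST). -/
theorem stub_bridgeChart : BridgeChartExists := by
  sorry

/-- Stub 3 — the tuning anchors the landing scale (uses `uv_bound` + drift count). LANDED: proved by the crux
disprover for verbatim copies of `BridgeChart/ScaleAnchoring` (`Theorems/LatticeGapOnTrajectory/Negative/StubAnchoring.lean`,
p74657, `Stubs.scaleAnchoring_holds`); definitionally the same statement. -/
theorem stub_anchoring : ScaleAnchoring := by
  intro G _ _ _ _ _ _ r M' S 𝔛 γ ρ hadm θ hθ
  -- field-by-field copy of the line's `BridgeChart` into the landed file's structure copy (same fields)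
  let 𝔛' : Summit.QuantumFields.YangMills.Theorems.LatticeGapOnTrajectory.Negative.Stubs.BridgeChart S :=
    { odd_M := 𝔛.odd_M, X := 𝔛.X, F := 𝔛.F, ι := 𝔛.ι, ι_step := 𝔛.ι_step, H := 𝔛.H, isOpen_H := 𝔛.isOpen_H,
      κ := 𝔛.κ, κ_pos := 𝔛.κ_pos, c₁ := 𝔛.c₁, transport := 𝔛.transport, Cuv := 𝔛.Cuv, uv_bound := 𝔛.uv_bound }
  exact Summit.QuantumFields.YangMills.Theorems.LatticeGapOnTrajectory.Negative.Stubs.scaleAnchoring_holds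
    G r M' S 𝔛' γ ρ hadm θ hθ

/-- Stub 4 — uniform lattice gap ⇒ transfer half by positivity (shared). -/
theorem stub_transfer : LatticeToTransfer := by
  sorry

/-! ### 7. The kernel-checked composition -/

/-- **Composition**: the four stub statements imply the crux BY NAME. Given the data of (B):
take the chart, tube and certificate (`BridgeChartExists`), the entrance coupling `g₁`
(`UVPassage`) and the lag `w(θ)` (`ScaleAnchoring`); set `Δ := κ / M'^{w+J}`. For the lattice
half fix `A, B` and the constant `C` of `transport`; eventually in `k`: `β_k` is a Wilson point
`g_k ≤ min g₁ g₂` (`exists_wilson_point`), the tuned correlator exceeds `θ/2`, and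
`a_k L_k ≥ (c₁ + M') M'^{w+J}` — ONE threshold `k₀` for all pairs, so the line proves the
`UniformLatticeGap`. Then the orbit of `g_k` enters the tube at its first passage
`j_k`, `tailTrapping` + the certificate put its `J`-th extended iterate in `H`, anchoring forces
`j_k ≤ ⌊log_{M'} M^{n_k}⌋ + w` (else the tuned correlator would be `≤ θ/2`), and `transport`
bounds every `|⟨A; τ_n B⟩|` on every torus `S ≥ L_k` by `C e^{−κ n / M'^{j_k+J}} ≤ C e^{−Δ a_k n}`.
The lattice half is `hasLatticeMassGap_of_uniformLatticeGap`, the transfer half `LatticeToTransfer`.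
[folklore] -/
theorem LatticeGapOnTrajectory_of :
    UVPassage → ScaleAnchoring → LatticeToTransfer → BridgeChartExists →
      Summit.QuantumFields.YangMills.Theses.ParabolicTrajectory.LatticeGapOnTrajectory := by
  intro hUV hAnch hTr hChart G _ _ _ _ hG
  letI : MeasurableSpace G := borel G
  haveI : BorelSpace G := ⟨rfl⟩
  intro r M θ sch n hM hθ hshape hβ htune
  -- the chart, the tube and the certificate
  obtain ⟨M', S, 𝔛, γ, ρ, hadm, P, N, ρt, θt, ηt, J, htrap, hstart, htarget⟩ := hChart G hG r
  -- entrance and anchoring data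
  obtain ⟨g₁, hg₁, hg₁₀, huv⟩ := hUV G r M' S γ ρ hadm
  obtain ⟨w, g₂, hg₂, hg₂₀, hanch⟩ := hAnch G r M' S 𝔛 γ ρ hadm θ hθ
  obtain ⟨β₁, hβ₁⟩ := exists_wilson_point S (lt_min hg₁ hg₂) ((min_le_left _ _).trans hg₁₀)
  -- constants
  have hM'2 : 2 ≤ M' := S.two_le_M
  have hM'pos : (0 : ℝ) < M' := by exact_mod_cast (show 0 < M' by omega)
  have hMpos : (0 : ℝ) < M := by exact_mod_cast (show 0 < M by omega)
  have hκ := 𝔛.κ_pos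
  have hΔpos : 0 < 𝔛.κ / (M' : ℝ) ^ (w + J) := by positivity
  -- ONE threshold k₀ for all pairs of observables
  have e1 : ∀ᶠ k in atTop, β₁ ≤ sch.β k := hβ.eventually_ge_atTop β₁
  have e2 : ∀ᶠ k in atTop, θ / 2 < ((M : ℝ) ^ n k) ^ 8 *
      latticeConnectedCorr r.ρ (sch.β k) (sch.side k) r.curvature.F r.curvature.F (M ^ n k) :=
    htune.eventually (lt_mem_nhds (by linarith))
  have e3 : ∀ᶠ k in atTop, (((𝔛.c₁ + M') * M' ^ (w + J) : ℕ) : ℝ) ≤ sch.a k * sch.L k :=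
    sch.tendsto_L.eventually_ge_atTop _
  obtain ⟨k₀, hk₀⟩ := Filter.eventually_atTop.1 (e1.and (e2.and e3))
  -- the uniform lattice gap
  have hunif : UniformLatticeGap r sch (𝔛.κ / (M' : ℝ) ^ (w + J)) := by
    refine ⟨k₀, fun A B => ?_⟩
    obtain ⟨C, hC⟩ := 𝔛.transport A B
    refine ⟨C, fun k hk T hT t ht => ?_⟩
    obtain ⟨hk1, hk2, hk3⟩ := hk₀ k hk
    -- the Wilson point of β_k
    obtain ⟨g, hg, hgβ⟩ := hβ₁ (sch.β k) hk1
    have hg1 : g ∈ Set.Ioc 0 g₁ := ⟨hg.1, hg.2.trans (min_le_left _ _)⟩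
    have hg2 : g ∈ Set.Ioc 0 g₂ := ⟨hg.1, hg.2.trans (min_le_right _ _)⟩
    have hg0 : g ∈ Set.Ioc 0 S.g₀ := ⟨hg.1, hg1.2.trans hg₁₀⟩
    -- entrance into the tube at the first passage j
    obtain ⟨j, hjT, hjC, hjlt⟩ := huv g hg1
    have htop : ∀ l ≤ j, (S.F^[l] (g, S.yW g)).1 ≤ tubeTop S γ := by
      intro l hl
      rcases Nat.lt_or_ge l j with hlj | hlj
      · exact (hjlt l hlj).le.trans (le_tubeTop S hadm.1.le)
      · have : l = j := le_antisymm hl hlj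
        subst this
        exact hjT.2.1
    -- the certified enclosure puts the J-th extended iterate into the polymer ball
    have hz := hstart _ hjT
    have htt := tailTrapping htrap (𝔛.ι (S.F^[j] (g, S.yW g))) hz.1 hz.2 J le_rfl
    have hH : 𝔛.F^[J] (𝔛.ι (S.F^[j] (g, S.yW g))) ∈ 𝔛.H := htarget _ htt.1 htt.2
    -- the physical scale D = M^{n k} and its chart step i = ⌊log_{M'} D⌋
    set D : ℕ := M ^ n k with hDdef
    have hDne : D ≠ 0 := pow_ne_zero _ (by omega)
    have hDreal : (D : ℝ) = (M : ℝ) ^ n k := by rw [hDdef]; push_cast; ring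
    have hDpos : (0 : ℝ) < (M : ℝ) ^ n k := by positivity
    set i : ℕ := Nat.log M' D with hidef
    have hi1 : M' ^ i ≤ D := Nat.pow_log_le_self M' hDne
    have hi2 : D < M' ^ (i + 1) := Nat.lt_pow_succ_log_self (by omega) D
    -- volume: (c₁ + M') M'^{w+J} D ≤ L_k
    have hvolR : ((𝔛.c₁ + M') * M' ^ (w + J) : ℝ) * (M : ℝ) ^ n k ≤ (sch.L k : ℝ) := by
      have h := mul_le_mul_of_nonneg_right hk3 hDpos.le
      have h' : sch.a k * (sch.L k : ℝ) * (M : ℝ) ^ n k = sch.L k := by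
        rw [hshape k]; field_simp
      have h'' : (((𝔛.c₁ + M') * M' ^ (w + J) : ℕ) : ℝ) = ((𝔛.c₁ + M') * M' ^ (w + J) : ℝ) := by
        push_cast; ring
      rw [h'', h'] at h
      exact h
    have hvol : (𝔛.c₁ + M') * M' ^ (w + J) * D ≤ sch.L k := by
      have : (((𝔛.c₁ + M') * M' ^ (w + J) * D : ℕ) : ℝ) ≤ (sch.L k : ℝ) := by
        push_cast; rw [hDreal]; exact hvolR
      exact_mod_cast this
    have hpow1 : 1 ≤ M' ^ (w + J) := Nat.one_le_pow _ _ (by omega)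
    have hvolD : M' * D ≤ sch.L k := by
      calc M' * D ≤ (𝔛.c₁ + M') * M' ^ (w + J) * D := by
            apply Nat.mul_le_mul_right
            calc M' = M' * 1 := (mul_one _).symm
              _ ≤ (𝔛.c₁ + M') * M' ^ (w + J) := Nat.mul_le_mul (Nat.le_add_left _ _) hpow1
        _ ≤ sch.L k := hvol
    -- anchoring: the landing step is at most w steps above the physical scale
    have hjw : j ≤ i + w := by
      by_contra hcon
      have hle : i + w ≤ j := by omega
      have hb := hanch g hg2 j hjC htop i (sch.L k) D hle hi1 hi2 hvolD
      rw [hgβ, hDreal] at hb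
      have hk2' : θ / 2 < ((M : ℝ) ^ n k) ^ 8 *
          latticeConnectedCorr r.ρ (sch.β k) (2 * sch.L k + 1) r.curvature.F r.curvature.F D := hk2
      have habs : ((M : ℝ) ^ n k) ^ 8 *
            latticeConnectedCorr r.ρ (sch.β k) (2 * sch.L k + 1) r.curvature.F r.curvature.F D ≤
          ((M : ℝ) ^ n k) ^ 8 *
            |latticeConnectedCorr r.ρ (sch.β k) (2 * sch.L k + 1) r.curvature.F r.curvature.F D| :=
        mul_le_mul_of_nonneg_left (le_abs_self _) (by positivity)
      linarith
    -- hence M'^{j+J} ≤ M'^{w+J} · D and the torus condition of `transport`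
    have hpowN : M' ^ (j + J) ≤ M' ^ (w + J) * D := by
      calc M' ^ (j + J) ≤ M' ^ (i + w + J) := Nat.pow_le_pow_right (by omega) (by omega)
        _ = M' ^ i * M' ^ (w + J) := by rw [show i + w + J = i + (w + J) by ring, pow_add]
        _ ≤ D * M' ^ (w + J) := Nat.mul_le_mul_right _ hi1
        _ = M' ^ (w + J) * D := mul_comm _ _
    have hpowR : ((M' : ℝ) ^ (j + J)) ≤ (M' : ℝ) ^ (w + J) * (M : ℝ) ^ n k := by
      have : ((M' ^ (j + J) : ℕ) : ℝ) ≤ ((M' ^ (w + J) * D : ℕ) : ℝ) := by exact_mod_cast hpowN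
      push_cast at this; rw [hDreal] at this; exact this
    have hTvol : 𝔛.c₁ * M' ^ (j + J) ≤ 2 * T + 1 := by
      calc 𝔛.c₁ * M' ^ (j + J) ≤ 𝔛.c₁ * (M' ^ (w + J) * D) := Nat.mul_le_mul_left _ hpowN
        _ ≤ (𝔛.c₁ + M') * M' ^ (w + J) * D := by
            rw [← mul_assoc]; exact Nat.mul_le_mul_right _ (Nat.mul_le_mul_right _ (by omega))
        _ ≤ sch.L k := hvol
        _ ≤ T := hT
        _ ≤ 2 * T + 1 := by omega
    -- the transported bound
    have hbound := hC g hg0 j hjC J hH T t hTvol ht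
    rw [hgβ] at hbound
    refine hbound.trans ?_
    have hC0 : 0 ≤ C := by
      by_contra hneg
      push Not at hneg
      have := (abs_nonneg _).trans hbound
      nlinarith [Real.exp_pos (-(𝔛.κ * t / (M' : ℝ) ^ (j + J)))]
    apply mul_le_mul_of_nonneg_left _ hC0
    apply Real.exp_le_exp.2
    -- −(κ t / M'^{j+J}) ≤ −(Δ (a_k t))
    have key : 𝔛.κ / (M' : ℝ) ^ (w + J) * (sch.a k * t) ≤ 𝔛.κ * t / (M' : ℝ) ^ (j + J) := by
      rw [hshape k]
      have h1 : 𝔛.κ / (M' : ℝ) ^ (w + J) * (((M : ℝ) ^ n k)⁻¹ * t) =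
          𝔛.κ * t / ((M' : ℝ) ^ (w + J) * (M : ℝ) ^ n k) := by
        field_simp
      rw [h1]
      exact div_le_div_of_nonneg_left (by positivity) (by positivity) hpowR
    linarith
  exact ⟨𝔛.κ / (M' : ℝ) ^ (w + J), hΔpos, hasLatticeMassGap_of_uniformLatticeGap r sch hunif,
    hTr G r sch _ hΔpos hβ hunif⟩

/-- **The skeleton**: the crux from the four registered stubs (sorries only inside `stub_*`). -/
theorem LatticeGapOnTrajectory_skeleton :
    Summit.QuantumFields.YangMills.Theses.ParabolicTrajectory.LatticeGapOnTrajectory :=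
  LatticeGapOnTrajectory_of stub_uvPassage stub_anchoring stub_transfer stub_bridgeChart

end Summit.QuantumFields.YangMills.Cruxes.LatticeGapOnTrajectory.DissipativeBridge

end
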